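import Literature.Probability.Moments.UStatisticBernstein
import Summits.Ventures.LatticeQCDFlow.Scoring.PairedDrawAcceptance
import HarnessLib

/-!
# The acceptance column from ALL PAIRS of model draws: Hoeffding's and Bernstein's certificates
# for the order-2 U-statistic of the pair-minimum of importance ratios

HONEST FRAMING: exact (Metropolis-corrected) sampling algorithms for lattice gauge theory;
figures of merit are autocorrelation/cost numbers at stated couplings and volumes; no
continuum-physics claim.

Venture `LatticeQCDFlow` (cell pub-lqcd), topic `Scoring`; FANOUT row 4 (`s0-u1-b`, rung S0-B: two
independent codes A, B for the 2D U(1) flow sampler; acceptance test "A vs B within 3 pp").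
`Scoring/PairedDrawAcceptance` (imported) certifies the equilibrium acceptance
`acc(p,q) = ∫∫ min(p(a)q(b), p(b)q(a)) dμ dμ = E min(w(x), w(x'))` (`w = p/q`) of the flow
(independence Metropolis) sampler from `k` DISJOINT pairs of a code's own proposals and left "the
all-pairs U-statistic (Hoeffding 1963 §5)" NOT CLAIMED.  This file claims it: from ONE stream of `n`
independent model draws `x₀, …, x_{n−1}` the natural estimator of `acc` uses every ordered pair,

  `Û = (Σ_{i ≠ j} min(w(xᵢ), w(xⱼ))) / (n(n−1))`

— the order-2 U-statistic of the kernel `min(w, w')` (its variance: `Scoring/UStatisticVariance`),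
written here as the average over the embeddings `e : Fin 2 ↪ Fin n` of `min(w(x_{e 0}), w(x_{e 1}))`
(`sum_embedding_fin_two_eq_sum_offDiag`: the same as the sum over `univ.offDiag`;
`card_embedding_fin_two`: `#(Fin 2 ↪ Fin n) = n(n−1)`).  The certificates are the tree's
formalisation of Hoeffding 1963 §5 / Serfling 1980 Thm 5.6.1.A (`Literature…UStatisticHoeffding`,
`…UStatisticBernstein`, m = 2, `k = ⌊n/2⌋`), fed with the pair facts of `PairedDrawAcceptance`
(kernel in `[0, W]` under the ceiling `p ≤ Wq`; mean `acc`; second moment, hence variance, `≤ 1`):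

* `integral_allPairs_eq_meanAccept` — `E Û = acc(p,q)` (unbiased);
* `acceptance_allPairs_hoeffding` — `P(|Û − acc| ≥ t) ≤ 2 exp(−2⌊n/2⌋ t²/W²)` (Thm A (1));
* `acceptance_allPairs_upper` — `P(Û − acc ≥ t) ≤ exp(−⌊n/2⌋ t²/(2(1 + Wt/3)))` (Thm A (2),
  `v = 1`, `B = W`), `acceptance_allPairs_lower` — `P(Û − acc ≤ −t) ≤ exp(−⌊n/2⌋ t²/(2(1 + t/3)))`
  (`B = 1 ≥ acc`: the lower tail does not see the ceiling at all), `acceptance_allPairs_confidence`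
  (two-sided, also in the `offDiag` form `acceptance_allPairs_confidence_offDiag`);
* `acceptance_AB_allPairs_confidence` — two codes `q, q'`, each certified from ITS OWN stream,
  NOTHING assumed between them: `P(t + t' ≤ |(Û − Û') − (acc(p,q) − acc(p,q'))|)` is at most the
  sum of the two two-sided bounds.

Reading for row 4 (value-free; no number of ours, no sealed value): the all-pairs estimate a code
prints from `n` proposals carries the same exponential certificate as `⌊n/2⌋` disjoint pairs
(Hoeffding's `k = [n/m]`; the gain of using all pairs is in the variance,
`Scoring/UStatisticVariance`, not in this exponent), with the ceiling `W` entering only the upper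
tail and only through `Wt/3`.  NEW WORK of the cell (elementary); the cited facts (Hoeffding 1963
§5, Serfling Thm 5.6.1.A, BLM (2.10)) are all PROVED in the tree; no definition is introduced.
NOT CLAIMED: unnormalised weights / the printed RATIO estimator; Arcones–Giné-type bounds with the
U-statistic's own (smaller) variance; the realised acceptance RATE of a finite chain; any number
re-scored.
-/

noncomputable section

namespace Summit.Ventures.LatticeQCDFlow.Scoring.AllPairs

open MeasureTheory ProbabilityTheory Finset Real Set
open Literature.Probability.Moments

/-! ## §1 Ordered pairs of distinct indices: embeddings `Fin 2 ↪ Fin n` versus `offDiag` -/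

section Pairs

variable {n : ℕ} {M : Type*} [AddCommMonoid M]

/-- **`#(Fin 2 ↪ Fin n) = n(n − 1)`** (ordered pairs of distinct indices). [folklore] -/
theorem card_embedding_fin_two : Fintype.card (Fin 2 ↪ Fin n) = n * (n - 1) := by
  rw [Fintype.card_embedding_eq, Fintype.card_fin, Fintype.card_fin, Nat.descFactorial_succ,
    Nat.descFactorial_one, mul_comm]

/-- **Summing over embeddings `Fin 2 ↪ Fin n` is summing over ordered pairs of distinct indices**:
`Σ_e F (e 0) (e 1) = Σ_{(i,j) ∈ univ.offDiag} F i j`. [folklore] -/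
theorem sum_embedding_fin_two_eq_sum_offDiag (F : Fin n → Fin n → M) :
    ∑ e : Fin 2 ↪ Fin n, F (e 0) (e 1) = ∑ ij ∈ (univ : Finset (Fin n)).offDiag, F ij.1 ij.2 := by
  refine Finset.sum_bij' (fun e _ => (e 0, e 1))
    (fun ij hij => ⟨![ij.1, ij.2], fun a b h => by
      have hne : ij.1 ≠ ij.2 := (Finset.mem_offDiag.1 hij).2.2
      fin_cases a <;> fin_cases b <;> simp_all⟩)
    (fun e _ => Finset.mem_offDiag.2 ⟨mem_univ _, mem_univ _, fun h =>
      absurd (e.injective h) (by decide)⟩)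
    (fun ij hij => mem_univ _) (fun e _ => ?_) (fun ij hij => rfl) (fun e _ => rfl)
  ext a
  fin_cases a <;> rfl

end Pairs

/-! ## §2 The pair-minimum kernel on `Fin 2 → X`: range, mean, variance along every pair -/

section Kernel

variable {Ω : Type*} [MeasurableSpace Ω] {P : Measure Ω} [IsProbabilityMeasure P]
variable {X : Type*} [MeasurableSpace X] {μ : Measure X} [SFinite μ] {n : ℕ}

omit [SFinite μ] in
/-- Measurability of the pair-minimum kernel `y ↦ min(p(y 0)/q(y 0), p(y 1)/q(y 1))` on
`Fin 2 → X`. [folklore] -/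
theorem measurable_pairMinKernel {p q : X → ℝ} (hpm : Measurable p) (hqm : Measurable q) :
    Measurable fun y : Fin 2 → X => min (p (y 0) / q (y 0)) (p (y 1) / q (y 1)) :=
  ((hpm.comp (measurable_pi_apply 0)).div (hqm.comp (measurable_pi_apply 0))).min
    ((hpm.comp (measurable_pi_apply 1)).div (hqm.comp (measurable_pi_apply 1)))

omit [MeasurableSpace X] [SFinite μ] in
/-- A weight ceiling `p ≤ Wq` with `∫ p = 1`, `p ≥ 0`, `q > 0` forces `W > 0`. [folklore] -/
theorem ceiling_pos [MeasurableSpace X] {μ : Measure X} {p q : X → ℝ} (hp0 : ∀ y, 0 ≤ p y)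
    (hp1 : ∫ y, p y ∂μ = 1) (hq0 : ∀ y, 0 < q y) {W : ℝ} (hW : ∀ y, p y ≤ W * q y) : 0 < W := by
  by_contra hW0
  push Not at hW0
  have hp : ∀ y, p y = 0 := fun y =>
    le_antisymm ((hW y).trans (mul_nonpos_of_nonpos_of_nonneg hW0 (hq0 y).le)) (hp0 y)
  have : ∫ y, p y ∂μ = 0 := by simp [hp]
  linarith

/-- **Along every ordered pair `e` of distinct indices the kernel has mean `acc(p, q)`** (the two
draws `x (e 0)`, `x (e 1)` are independent: `PairedDraws.integral_pairMin_comp_eq_meanAccept`).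
[ours] -/
theorem integral_pairMinKernel_eq_meanAccept {x : Fin n → Ω → X} (hxm : ∀ i, Measurable (x i))
    (hind : iIndepFun x P) {p q : X → ℝ} (hp0 : ∀ y, 0 ≤ p y) (hpm : Measurable p)
    (hpi : Integrable p μ) (hq0 : ∀ y, 0 < q y) (hqm : Measurable q) (hqi : Integrable q μ)
    (hlaw : ∀ i, Measure.map (x i) P = μ.withDensity fun y => ENNReal.ofReal (q y))
    (e : Fin 2 ↪ Fin n) :
    ∫ ω, min (p (x (e 0) ω) / q (x (e 0) ω)) (p (x (e 1) ω) / q (x (e 1) ω)) ∂P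
      = ∫ a, ∫ b, min (p a * q b) (p b * q a) ∂μ ∂μ :=
  PairedDraws.integral_pairMin_comp_eq_meanAccept (hxm _) (hxm _)
    (hind.indepFun (fun h => absurd (e.injective h) (by decide))) hp0 hpm hpi hq0 hqm hqi (hlaw _)
    (hlaw _)

/-- **Along every ordered pair the kernel has variance `≤ 1`** (variance `≤` second moment
`≤ E[w(x)w(x')] = 1`, `PairedDraws.integral_sq_pairMin_comp_le_one`; no ceiling enters). [ours] -/
theorem variance_pairMinKernel_le_one {x : Fin n → Ω → X} (hxm : ∀ i, Measurable (x i))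
    (hind : iIndepFun x P) {p q : X → ℝ} (hp0 : ∀ y, 0 ≤ p y) (hpm : Measurable p)
    (hpi : Integrable p μ) (hp1 : ∫ y, p y ∂μ = 1) (hq0 : ∀ y, 0 < q y) (hqm : Measurable q)
    {W : ℝ} (hW : ∀ y, p y ≤ W * q y)
    (hlaw : ∀ i, Measure.map (x i) P = μ.withDensity fun y => ENNReal.ofReal (q y))
    (e : Fin 2 ↪ Fin n) :
    Var[fun ω => min (p (x (e 0) ω) / q (x (e 0) ω)) (p (x (e 1) ω) / q (x (e 1) ω)); P] ≤ 1 := by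
  have hm : AEStronglyMeasurable
      (fun ω => min (p (x (e 0) ω) / q (x (e 0) ω)) (p (x (e 1) ω) / q (x (e 1) ω))) P :=
    ((measurable_pairMinKernel hpm hqm).comp
      (measurable_pi_lambda _ fun l => hxm (e l))).aestronglyMeasurable
  have hLp : MemLp (fun ω => min (p (x (e 0) ω) / q (x (e 0) ω)) (p (x (e 1) ω) / q (x (e 1) ω)))
      2 P :=
    MemLp.of_bound hm W (Filter.Eventually.of_forall fun ω => by
      have h := PairedDraws.pairMin_mem_Icc hp0 hq0 hW (x (e 0) ω, x (e 1) ω)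
      rw [Real.norm_eq_abs, abs_of_nonneg h.1]; exact h.2)
  rw [variance_eq_sub hLp]
  have h2 := PairedDraws.integral_sq_pairMin_comp_le_one (hxm _) (hxm _)
    (hind.indepFun (fun h => absurd (e.injective h) (by decide))) hp0 hpm hpi hp1 hq0 hqm (hlaw _)
    (hlaw _) (x := x (e 0)) (x' := x (e 1))
  simp only [Pi.pow_apply] at h2 ⊢
  nlinarith [sq_nonneg
    (∫ ω, min (p (x (e 0) ω) / q (x (e 0) ω)) (p (x (e 1) ω) / q (x (e 1) ω)) ∂P)]

/-! ## §3 Certificates for the all-pairs estimator -/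

/-- The average of the kernel means over all embeddings is `acc(p, q)`. [ours] -/
theorem mean_allPairs_eq_meanAccept {x : Fin n → Ω → X} (hxm : ∀ i, Measurable (x i))
    (hind : iIndepFun x P) {p q : X → ℝ} (hp0 : ∀ y, 0 ≤ p y) (hpm : Measurable p)
    (hpi : Integrable p μ) (hq0 : ∀ y, 0 < q y) (hqm : Measurable q) (hqi : Integrable q μ)
    (hlaw : ∀ i, Measure.map (x i) P = μ.withDensity fun y => ENNReal.ofReal (q y)) (hn : 2 ≤ n) :
    (∑ e : Fin 2 ↪ Fin n,
        ∫ ω, min (p (x (e 0) ω) / q (x (e 0) ω)) (p (x (e 1) ω) / q (x (e 1) ω)) ∂P)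
        / Fintype.card (Fin 2 ↪ Fin n)
      = ∫ a, ∫ b, min (p a * q b) (p b * q a) ∂μ ∂μ := by
  have hN : 0 < Fintype.card (Fin 2 ↪ Fin n) := Fintype.card_pos_iff.2 ⟨Fin.castLEEmb hn⟩
  rw [Finset.sum_congr rfl fun e _ =>
      integral_pairMinKernel_eq_meanAccept hxm hind hp0 hpm hpi hq0 hqm hqi hlaw e,
    sum_const, card_univ, nsmul_eq_mul, mul_div_cancel_left₀ _ (by exact_mod_cast hN.ne')]

/-- **Unbiasedness: `E Û = acc(p, q)`.** [ours] -/
theorem integral_allPairs_eq_meanAccept {x : Fin n → Ω → X} (hxm : ∀ i, Measurable (x i))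
    (hind : iIndepFun x P) {p q : X → ℝ} (hp0 : ∀ y, 0 ≤ p y) (hpm : Measurable p)
    (hpi : Integrable p μ) (hq0 : ∀ y, 0 < q y) (hqm : Measurable q) (hqi : Integrable q μ)
    {W : ℝ} (hW : ∀ y, p y ≤ W * q y)
    (hlaw : ∀ i, Measure.map (x i) P = μ.withDensity fun y => ENNReal.ofReal (q y)) (hn : 2 ≤ n) :
    ∫ ω, (∑ e : Fin 2 ↪ Fin n, min (p (x (e 0) ω) / q (x (e 0) ω)) (p (x (e 1) ω) / q (x (e 1) ω)))
        / Fintype.card (Fin 2 ↪ Fin n) ∂P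
      = ∫ a, ∫ b, min (p a * q b) (p b * q a) ∂μ ∂μ := by
  rw [← mean_allPairs_eq_meanAccept hxm hind hp0 hpm hpi hq0 hqm hqi hlaw hn]
  exact UStatistic.integral_eq
    (g := fun y : Fin 2 → X => min (p (y 0) / q (y 0)) (p (y 1) / q (y 1))) hxm
    (measurable_pairMinKernel hpm hqm) fun y => PairedDraws.pairMin_mem_Icc hp0 hq0 hW (y 0, y 1)

/-- **HOEFFDING CERTIFICATE (Serfling Thm 5.6.1.A (1), m = 2):** `n ≥ 2` independent model draws,
ceiling `p ≤ Wq`, `t ≥ 0`: `P(|Û − acc(p,q)| ≥ t) ≤ 2 exp(−2⌊n/2⌋ t²/W²)`. [ours] -/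
theorem acceptance_allPairs_hoeffding {x : Fin n → Ω → X} (hxm : ∀ i, Measurable (x i))
    (hind : iIndepFun x P) {p q : X → ℝ} (hp0 : ∀ y, 0 ≤ p y) (hpm : Measurable p)
    (hpi : Integrable p μ) (hq0 : ∀ y, 0 < q y) (hqm : Measurable q) (hqi : Integrable q μ)
    {W : ℝ} (hW : ∀ y, p y ≤ W * q y)
    (hlaw : ∀ i, Measure.map (x i) P = μ.withDensity fun y => ENNReal.ofReal (q y)) (hn : 2 ≤ n)
    {t : ℝ} (ht : 0 ≤ t) :
    P.real {ω | t ≤ |(∑ e : Fin 2 ↪ Fin n,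
          min (p (x (e 0) ω) / q (x (e 0) ω)) (p (x (e 1) ω) / q (x (e 1) ω)))
          / Fintype.card (Fin 2 ↪ Fin n) - ∫ a, ∫ b, min (p a * q b) (p b * q a) ∂μ ∂μ|}
      ≤ 2 * exp (-(2 * (n / 2 : ℕ) * t ^ 2 / W ^ 2)) := by
  have h := UStatistic.measureReal_le_abs_sub_mean_le
    (g := fun y : Fin 2 → X => min (p (y 0) / q (y 0)) (p (y 1) / q (y 1))) hxm hind
    (measurable_pairMinKernel hpm hqm) (fun y => PairedDraws.pairMin_mem_Icc hp0 hq0 hW (y 0, y 1))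
    two_pos hn ht
  rw [mean_allPairs_eq_meanAccept hxm hind hp0 hpm hpi hq0 hqm hqi hlaw hn, sub_zero] at h
  exact h

/-- **BERNSTEIN CERTIFICATE, upper tail (Thm A (2) with `v = 1`, `B = W`):** for `t > 0`,
`P(Û − acc(p,q) ≥ t) ≤ exp(−⌊n/2⌋ t²/(2(1 + Wt/3)))`. [ours] -/
theorem acceptance_allPairs_upper {x : Fin n → Ω → X} (hxm : ∀ i, Measurable (x i))
    (hind : iIndepFun x P) {p q : X → ℝ} (hp0 : ∀ y, 0 ≤ p y) (hpm : Measurable p)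
    (hpi : Integrable p μ) (hp1 : ∫ y, p y ∂μ = 1) (hq0 : ∀ y, 0 < q y) (hqm : Measurable q)
    (hqi : Integrable q μ) {W : ℝ} (hW : ∀ y, p y ≤ W * q y)
    (hlaw : ∀ i, Measure.map (x i) P = μ.withDensity fun y => ENNReal.ofReal (q y)) (hn : 2 ≤ n)
    {t : ℝ} (ht : 0 < t) :
    P.real {ω | t ≤ (∑ e : Fin 2 ↪ Fin n,
          min (p (x (e 0) ω) / q (x (e 0) ω)) (p (x (e 1) ω) / q (x (e 1) ω)))
          / Fintype.card (Fin 2 ↪ Fin n) - ∫ a, ∫ b, min (p a * q b) (p b * q a) ∂μ ∂μ}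
      ≤ exp (-((n / 2 : ℕ) * t ^ 2 / (2 * (1 + W * t / 3)))) := by
  have hW0 : 0 < W := ceiling_pos (μ := μ) hp0 hp1 hq0 hW
  have hle : ∀ e : Fin 2 ↪ Fin n, ∀ᵐ ω ∂P,
      min (p (x (e 0) ω) / q (x (e 0) ω)) (p (x (e 1) ω) / q (x (e 1) ω))
        - ∫ ω', min (p (x (e 0) ω') / q (x (e 0) ω')) (p (x (e 1) ω') / q (x (e 1) ω')) ∂P ≤ W :=
    fun e => ae_of_all _ fun ω => by
      rw [integral_pairMinKernel_eq_meanAccept hxm hind hp0 hpm hpi hq0 hqm hqi hlaw e]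
      have h1 := (PairedDraws.pairMin_mem_Icc hp0 hq0 hW (x (e 0) ω, x (e 1) ω)).2
      have h2 : 0 ≤ ∫ a, ∫ b, min (p a * q b) (p b * q a) ∂μ ∂μ :=
        integral_nonneg fun a => integral_nonneg fun b =>
          le_min (mul_nonneg (hp0 _) (hq0 _).le) (mul_nonneg (hp0 _) (hq0 _).le)
      simp only at h1
      linarith
  have h := UStatistic.measureReal_le_sub_mean_le_exp_bernstein
    (g := fun y : Fin 2 → X => min (p (y 0) / q (y 0)) (p (y 1) / q (y 1))) hxm hind
    (measurable_pairMinKernel hpm hqm) (fun y => PairedDraws.pairMin_mem_Icc hp0 hq0 hW (y 0, y 1))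
    two_pos hn one_pos hW0
    (fun e => variance_pairMinKernel_le_one hxm hind hp0 hpm hpi hp1 hq0 hqm hW hlaw e) hle ht
  rw [mean_allPairs_eq_meanAccept hxm hind hp0 hpm hpi hq0 hqm hqi hlaw hn] at h
  exact h

/-- **BERNSTEIN CERTIFICATE, lower tail (Thm A (2) for `−min`, `v = 1`, `B = 1 ≥ acc`): the
ceiling does not enter.**  For `t > 0`, `P(Û − acc(p,q) ≤ −t) ≤ exp(−⌊n/2⌋ t²/(2(1 + t/3)))`.
[ours] -/
theorem acceptance_allPairs_lower {x : Fin n → Ω → X} (hxm : ∀ i, Measurable (x i))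
    (hind : iIndepFun x P) {p q : X → ℝ} (hp0 : ∀ y, 0 ≤ p y) (hpm : Measurable p)
    (hpi : Integrable p μ) (hp1 : ∫ y, p y ∂μ = 1) (hq0 : ∀ y, 0 < q y) (hqm : Measurable q)
    (hqi : Integrable q μ) {W : ℝ} (hW : ∀ y, p y ≤ W * q y)
    (hlaw : ∀ i, Measure.map (x i) P = μ.withDensity fun y => ENNReal.ofReal (q y)) (hn : 2 ≤ n)
    {t : ℝ} (ht : 0 < t) :
    P.real {ω | (∑ e : Fin 2 ↪ Fin n,
          min (p (x (e 0) ω) / q (x (e 0) ω)) (p (x (e 1) ω) / q (x (e 1) ω)))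
          / Fintype.card (Fin 2 ↪ Fin n) - ∫ a, ∫ b, min (p a * q b) (p b * q a) ∂μ ∂μ ≤ -t}
      ≤ exp (-((n / 2 : ℕ) * t ^ 2 / (2 * (1 + 1 * t / 3)))) := by
  -- `acc(p,q) ≤ 1`: `(E m)² ≤ E m² ≤ 1` for the pair-minimum `m` of any one pair (variance ≥ 0)
  have hacc1 : ∫ a, ∫ b, min (p a * q b) (p b * q a) ∂μ ∂μ ≤ 1 := by
    obtain ⟨e⟩ : Nonempty (Fin 2 ↪ Fin n) := ⟨Fin.castLEEmb hn⟩
    rw [← integral_pairMinKernel_eq_meanAccept hxm hind hp0 hpm hpi hq0 hqm hqi hlaw e]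
    have hLp : MemLp (fun ω => min (p (x (e 0) ω) / q (x (e 0) ω)) (p (x (e 1) ω) / q (x (e 1) ω)))
        2 P :=
      MemLp.of_bound (((measurable_pairMinKernel hpm hqm).comp
        (measurable_pi_lambda _ fun l => hxm (e l))).aestronglyMeasurable) W
        (Filter.Eventually.of_forall fun ω => by
          have h := PairedDraws.pairMin_mem_Icc hp0 hq0 hW (x (e 0) ω, x (e 1) ω)
          rw [Real.norm_eq_abs, abs_of_nonneg h.1]; exact h.2)
    have hv := variance_nonneg
      (fun ω => min (p (x (e 0) ω) / q (x (e 0) ω)) (p (x (e 1) ω) / q (x (e 1) ω))) P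
    rw [variance_eq_sub hLp] at hv
    have h2 := PairedDraws.integral_sq_pairMin_comp_le_one (hxm _) (hxm _)
      (hind.indepFun (fun h => absurd (e.injective h) (by decide))) hp0 hpm hpi hp1 hq0 hqm (hlaw _)
      (hlaw _) (x := x (e 0)) (x' := x (e 1))
    simp only [Pi.pow_apply] at hv h2
    have hm0 : 0 ≤ ∫ ω, min (p (x (e 0) ω) / q (x (e 0) ω)) (p (x (e 1) ω) / q (x (e 1) ω)) ∂P :=
      integral_nonneg fun ω => (PairedDraws.pairMin_mem_Icc hp0 hq0 hW (x (e 0) ω, x (e 1) ω)).1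
    nlinarith
  have hge : ∀ e : Fin 2 ↪ Fin n, ∀ᵐ ω ∂P,
      (∫ ω', min (p (x (e 0) ω') / q (x (e 0) ω')) (p (x (e 1) ω') / q (x (e 1) ω')) ∂P)
        - min (p (x (e 0) ω) / q (x (e 0) ω)) (p (x (e 1) ω) / q (x (e 1) ω)) ≤ 1 :=
    fun e => ae_of_all _ fun ω => by
      rw [integral_pairMinKernel_eq_meanAccept hxm hind hp0 hpm hpi hq0 hqm hqi hlaw e]
      have h1 := (PairedDraws.pairMin_mem_Icc hp0 hq0 hW (x (e 0) ω, x (e 1) ω)).1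
      simp only at h1
      linarith
  have h := UStatistic.measureReal_sub_mean_le_neg_le_exp_bernstein
    (g := fun y : Fin 2 → X => min (p (y 0) / q (y 0)) (p (y 1) / q (y 1))) hxm hind
    (measurable_pairMinKernel hpm hqm) (fun y => PairedDraws.pairMin_mem_Icc hp0 hq0 hW (y 0, y 1))
    two_pos hn one_pos one_pos
    (fun e => variance_pairMinKernel_le_one hxm hind hp0 hpm hpi hp1 hq0 hqm hW hlaw e) hge ht
  rw [mean_allPairs_eq_meanAccept hxm hind hp0 hpm hpi hq0 hqm hqi hlaw hn] at h
  exact h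

/-- **TWO-SIDED BERNSTEIN CERTIFICATE for the all-pairs acceptance estimate:** for `t > 0`,
`P(|Û − acc(p,q)| ≥ t) ≤ exp(−⌊n/2⌋t²/(2(1 + t/3))) + exp(−⌊n/2⌋t²/(2(1 + Wt/3)))`. [ours] -/
theorem acceptance_allPairs_confidence {x : Fin n → Ω → X} (hxm : ∀ i, Measurable (x i))
    (hind : iIndepFun x P) {p q : X → ℝ} (hp0 : ∀ y, 0 ≤ p y) (hpm : Measurable p)
    (hpi : Integrable p μ) (hp1 : ∫ y, p y ∂μ = 1) (hq0 : ∀ y, 0 < q y) (hqm : Measurable q)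
    (hqi : Integrable q μ) {W : ℝ} (hW : ∀ y, p y ≤ W * q y)
    (hlaw : ∀ i, Measure.map (x i) P = μ.withDensity fun y => ENNReal.ofReal (q y)) (hn : 2 ≤ n)
    {t : ℝ} (ht : 0 < t) :
    P.real {ω | t ≤ |(∑ e : Fin 2 ↪ Fin n,
          min (p (x (e 0) ω) / q (x (e 0) ω)) (p (x (e 1) ω) / q (x (e 1) ω)))
          / Fintype.card (Fin 2 ↪ Fin n) - ∫ a, ∫ b, min (p a * q b) (p b * q a) ∂μ ∂μ|}
      ≤ exp (-((n / 2 : ℕ) * t ^ 2 / (2 * (1 + t / 3))))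
        + exp (-((n / 2 : ℕ) * t ^ 2 / (2 * (1 + W * t / 3)))) := by
  have hup := acceptance_allPairs_upper hxm hind hp0 hpm hpi hp1 hq0 hqm hqi hW hlaw hn ht
  have hlo := acceptance_allPairs_lower hxm hind hp0 hpm hpi hp1 hq0 hqm hqi hW hlaw hn ht
  rw [one_mul] at hlo
  set D : Ω → ℝ := fun ω => (∑ e : Fin 2 ↪ Fin n,
      min (p (x (e 0) ω) / q (x (e 0) ω)) (p (x (e 1) ω) / q (x (e 1) ω)))
      / Fintype.card (Fin 2 ↪ Fin n) - ∫ a, ∫ b, min (p a * q b) (p b * q a) ∂μ ∂μ with hD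
  have hsub : {ω | t ≤ |D ω|} ⊆ {ω | D ω ≤ -t} ∪ {ω | t ≤ D ω} := by
    intro ω hω
    simp only [mem_setOf_eq, mem_union] at hω ⊢
    rcases le_abs.1 hω with h | h
    · exact Or.inr h
    · left; linarith
  calc P.real {ω | t ≤ |D ω|} ≤ P.real ({ω | D ω ≤ -t} ∪ {ω | t ≤ D ω}) := measureReal_mono hsub
    _ ≤ P.real {ω | D ω ≤ -t} + P.real {ω | t ≤ D ω} := measureReal_union_le _ _
    _ ≤ _ := add_le_add hlo hup

/-- The same certificate with the estimator written as the average over `univ.offDiag` of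
`min(w(xᵢ), w(xⱼ))` divided by `n(n−1)`. [ours] -/
theorem acceptance_allPairs_confidence_offDiag {x : Fin n → Ω → X} (hxm : ∀ i, Measurable (x i))
    (hind : iIndepFun x P) {p q : X → ℝ} (hp0 : ∀ y, 0 ≤ p y) (hpm : Measurable p)
    (hpi : Integrable p μ) (hp1 : ∫ y, p y ∂μ = 1) (hq0 : ∀ y, 0 < q y) (hqm : Measurable q)
    (hqi : Integrable q μ) {W : ℝ} (hW : ∀ y, p y ≤ W * q y)
    (hlaw : ∀ i, Measure.map (x i) P = μ.withDensity fun y => ENNReal.ofReal (q y)) (hn : 2 ≤ n)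
    {t : ℝ} (ht : 0 < t) :
    P.real {ω | t ≤ |(∑ ij ∈ (univ : Finset (Fin n)).offDiag,
          min (p (x ij.1 ω) / q (x ij.1 ω)) (p (x ij.2 ω) / q (x ij.2 ω))) / (n * (n - 1) : ℕ)
          - ∫ a, ∫ b, min (p a * q b) (p b * q a) ∂μ ∂μ|}
      ≤ exp (-((n / 2 : ℕ) * t ^ 2 / (2 * (1 + t / 3))))
        + exp (-((n / 2 : ℕ) * t ^ 2 / (2 * (1 + W * t / 3)))) := by
  have h := acceptance_allPairs_confidence hxm hind hp0 hpm hpi hp1 hq0 hqm hqi hW hlaw hn ht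
  have hsum : ∀ ω, (∑ e : Fin 2 ↪ Fin n,
      min (p (x (e 0) ω) / q (x (e 0) ω)) (p (x (e 1) ω) / q (x (e 1) ω)))
      = ∑ ij ∈ (univ : Finset (Fin n)).offDiag,
          min (p (x ij.1 ω) / q (x ij.1 ω)) (p (x ij.2 ω) / q (x ij.2 ω)) := fun ω =>
    sum_embedding_fin_two_eq_sum_offDiag fun i j =>
      min (p (x i ω) / q (x i ω)) (p (x j ω) / q (x j ω))
  simp only [hsum, card_embedding_fin_two] at h
  exact h

/-! ## §4 The A-vs-B acceptance comparison from two all-pairs estimates -/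

/-- **A-vs-B ACCEPTANCE COMPARISON FROM ALL PAIRS, NO PARITY HYPOTHESIS.**  One normalised target
`p ≥ 0`; two codes with model densities `q, q' > 0` and ceilings `p ≤ Wq`, `p ≤ W'q'`; code A
supplies `n ≥ 2` independent draws of its own (all-pairs estimate `Û`), code B supplies `n' ≥ 2`
(`Û'`); nothing is assumed between the two streams.  For `t, t' > 0`:
`P( t + t' ≤ |(Û − Û') − (acc(p,q) − acc(p,q'))| )` is at most the sum of the two two-sided
Bernstein certificates. [ours] -/
theorem acceptance_AB_allPairs_confidence {p q q' : X → ℝ} (hp0 : ∀ y, 0 ≤ p y)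
    (hpm : Measurable p) (hpi : Integrable p μ) (hp1 : ∫ y, p y ∂μ = 1) (hq0 : ∀ y, 0 < q y)
    (hqm : Measurable q) (hqi : Integrable q μ) (hq0' : ∀ y, 0 < q' y) (hqm' : Measurable q')
    (hqi' : Integrable q' μ) {W W' : ℝ} (hW : ∀ y, p y ≤ W * q y) (hW' : ∀ y, p y ≤ W' * q' y)
    {n n' : ℕ} {x : Fin n → Ω → X} (hxm : ∀ i, Measurable (x i)) (hind : iIndepFun x P)
    (hlaw : ∀ i, Measure.map (x i) P = μ.withDensity fun y => ENNReal.ofReal (q y))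
    {z : Fin n' → Ω → X} (hzm : ∀ j, Measurable (z j)) (hindz : iIndepFun z P)
    (hlawz : ∀ j, Measure.map (z j) P = μ.withDensity fun y => ENNReal.ofReal (q' y))
    (hn : 2 ≤ n) (hn' : 2 ≤ n') {t t' : ℝ} (ht : 0 < t) (ht' : 0 < t') :
    P.real {ω | t + t'
        ≤ |((∑ e : Fin 2 ↪ Fin n,
                min (p (x (e 0) ω) / q (x (e 0) ω)) (p (x (e 1) ω) / q (x (e 1) ω)))
              / Fintype.card (Fin 2 ↪ Fin n)
            - (∑ e : Fin 2 ↪ Fin n',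
                min (p (z (e 0) ω) / q' (z (e 0) ω)) (p (z (e 1) ω) / q' (z (e 1) ω)))
              / Fintype.card (Fin 2 ↪ Fin n'))
            - ((∫ a, ∫ b, min (p a * q b) (p b * q a) ∂μ ∂μ)
              - ∫ a, ∫ b, min (p a * q' b) (p b * q' a) ∂μ ∂μ)|}
      ≤ (exp (-((n / 2 : ℕ) * t ^ 2 / (2 * (1 + t / 3))))
          + exp (-((n / 2 : ℕ) * t ^ 2 / (2 * (1 + W * t / 3)))))
        + (exp (-((n' / 2 : ℕ) * t' ^ 2 / (2 * (1 + t' / 3))))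
          + exp (-((n' / 2 : ℕ) * t' ^ 2 / (2 * (1 + W' * t' / 3))))) := by
  have hA := acceptance_allPairs_confidence hxm hind hp0 hpm hpi hp1 hq0 hqm hqi hW hlaw hn ht
  have hB := acceptance_allPairs_confidence hzm hindz hp0 hpm hpi hp1 hq0' hqm' hqi' hW' hlawz hn'
    ht'
  set acc : ℝ := ∫ a, ∫ b, min (p a * q b) (p b * q a) ∂μ ∂μ
  set acc' : ℝ := ∫ a, ∫ b, min (p a * q' b) (p b * q' a) ∂μ ∂μ
  set U : Ω → ℝ := fun ω =>
    (∑ e : Fin 2 ↪ Fin n, min (p (x (e 0) ω) / q (x (e 0) ω)) (p (x (e 1) ω) / q (x (e 1) ω)))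
      / Fintype.card (Fin 2 ↪ Fin n)
  set U' : Ω → ℝ := fun ω =>
    (∑ e : Fin 2 ↪ Fin n', min (p (z (e 0) ω) / q' (z (e 0) ω)) (p (z (e 1) ω) / q' (z (e 1) ω)))
      / Fintype.card (Fin 2 ↪ Fin n')
  have hsub : {ω | t + t' ≤ |(U ω - U' ω) - (acc - acc')|}
      ⊆ {ω | t ≤ |U ω - acc|} ∪ {ω | t' ≤ |U' ω - acc'|} := by
    intro ω hω
    simp only [mem_setOf_eq, mem_union] at hω ⊢
    by_contra hcon
    obtain ⟨h1, h2⟩ := not_or.mp hcon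
    have : |(U ω - U' ω) - (acc - acc')| ≤ |U ω - acc| + |U' ω - acc'| := by
      rw [show (U ω - U' ω) - (acc - acc') = (U ω - acc) - (U' ω - acc') by ring]
      exact abs_sub _ _
    linarith [not_le.mp h1, not_le.mp h2]
  calc P.real {ω | t + t' ≤ |(U ω - U' ω) - (acc - acc')|}
      ≤ P.real ({ω | t ≤ |U ω - acc|} ∪ {ω | t' ≤ |U' ω - acc'|}) := measureReal_mono hsub
    _ ≤ P.real {ω | t ≤ |U ω - acc|} + P.real {ω | t' ≤ |U' ω - acc'|} :=
        measureReal_union_le _ _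
    _ ≤ _ := add_le_add hA hB

end Kernel

end Summit.Ventures.LatticeQCDFlow.Scoring.AllPairs

end
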